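import Summits.NavierStokesRegularity.NavierStokesRegularity.Theorems.EulerZoomLiouvillePowerGaugeEulerLiouvilleWeakRenormalizedTransportMember
import Summits.NavierStokesRegularity.NavierStokesRegularity.Theorems.EulerZoomLiouvillePowerGaugeEulerLiouvilleSelfSimilarHighSetFluxTools

/-!
# «BERNOULLI BANDS ARE KINETICALLY THIN» and «NO BERNOULLI PLATEAUS OFF THE SIMILARITY-STAGNATION SET» — in the WEAK class
# (crux `EulerZoomLiouville.PowerGaugeEulerLiouville` = stmt-NavierStokesRegularity-19832, line `birth`, open stub `stub_selfSimilarWeakRest`)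

Width seat `ns-ezl-w1` (g7) under the crux LEAD, cell ns-regularity-ideate.  First CONSEQUENCE of the renormalised transport law
`div(β(ℋ)W) = 3γβ(ℋ) − (1−2γ)β′(ℋ)|W|²` (`…WeakRenormalizedTransport`): test it with the `arctan` ramp
`β(s) = arctan((s − m)/δ)` (`|β| ≤ π/2`, `0 ≤ β′ ≤ 1/δ`, `β′ ≥ 1/(2δ)` on the band `|s − m| ≤ δ`) and the Tao cutoff
`θ = θ_{2L,L}` (`= 1` on `B_L`, `|Dθ(x)[w]| ≤ (M/L²)|⟪x,w⟫|`):

  `(1−2γ)/(2δ) ∫_{B_L ∩ {|ℋ−m| ≤ δ}} |W|² ≤ (1−2γ)∫ θ β′(ℋ)|W|² = ∫ β(ℋ)⟪W,∇θ⟫ + 3γ∫θβ(ℋ) ≤ C L³`,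

the right side by the `A`-growth `∫_{B_L}|V|² ≤ c_A L³` of the class.  Hence, for a weak class profile with `0 ≤ γ < ½`:

* **`WeakRenormalized.setIntegral_band_norm_transport_sq_le`** — «BERNOULLI BANDS ARE KINETICALLY THIN»: there is `C` with
  `∫_{B_L ∩ {|ℋ − m| ≤ δ}} |W|² ≤ C δ L³` for all `L ≥ max L₀ 1`, all levels `m` and all widths `δ > 0` — a Bernoulli band of width `δ`
  carries only the fraction `≍ δ/L²` of the similarity kinetic energy `∫_{B_L}|W|² ≍ L⁵` (the Eulerian form of «a similarity orbit
  crosses a band of width `δ` in time `δ/((1−2γ)|W|²)`», CIV (3.31));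
* **`WeakRenormalized.volume_level_inter_eq_zero`** — «NO BERNOULLI PLATEAUS»: for every level `m`,
  `vol({ℋ = m} ∩ {W ≠ 0}) = 0`: the level sets of the (merely `W^{1,1}_loc`) Bernoulli function of a weak class profile are
  Lebesgue-null off the similarity-stagnation set `{W = 0}` — a plateau of `ℋ` can only sit on hovering fluid;
* member level `…_of_past` / `…_of_selfSimilar` (crux hypotheses verbatim, `0 < ρ ≤ ½`).

WHAT THIS IS NOT: not NS, not E, not the stub — weak-class PORTRAIT TOOLS (`--supports` stmt-19832): in the genuinely weak stratum too the
only place where the Bernoulli landscape can be flat or slowly crossed is the hovering face `W ≈ 0`.  No summit statement is proved here;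
19832 OPEN. [folklore; cf. ConstantinIgnatovaVicol2026Putative §3.4.3 (3.31); Tao2011 §8 (58)]
-/

noncomputable section

set_option linter.dupNamespace false
-- nested operator types (`innerSL … ∘L …`)
set_option maxSynthPendingDepth 3

open MeasureTheory Set Filter Topology Metric Function TopologicalSpace
open scoped ENNReal NNReal RealInnerProductSpace ContDiff

namespace Summit.NavierStokesRegularity.NavierStokesRegularity.Theorems.PowerGaugeEulerLiouville

open Literature.Analysis Literature.Analysis.FunctionSpaces Literature.Analysis.FluidPDE

namespace WeakRenormalized

variable {V : EuclideanSpace ℝ (Fin 3) → EuclideanSpace ℝ (Fin 3)} {P : EuclideanSpace ℝ (Fin 3) → ℝ}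
  {G : EuclideanSpace ℝ (Fin 3) → EuclideanSpace ℝ (Fin 3) →L[ℝ] EuclideanSpace ℝ (Fin 3)}

/-! ## The `arctan` ramp -/

section Ramp

/-- The derivative of the ramp `s ↦ arctan((s − m)/δ)`. [folklore] -/
theorem hasDerivAt_arctanRamp (m δ s : ℝ) :
    HasDerivAt (fun s : ℝ => Real.arctan ((s - m) / δ)) (1 / (1 + ((s - m) / δ) ^ 2) * (1 / δ)) s := by
  have h1 : HasDerivAt (fun s : ℝ => (s - m) / δ) (1 / δ) s := by
    simpa using ((hasDerivAt_id s).sub_const m).div_const δ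
  exact (Real.hasDerivAt_arctan _).comp s h1

/-- `deriv` of the ramp. [folklore] -/
theorem deriv_arctanRamp (m δ s : ℝ) :
    deriv (fun s : ℝ => Real.arctan ((s - m) / δ)) s = 1 / (1 + ((s - m) / δ) ^ 2) * (1 / δ) :=
  (hasDerivAt_arctanRamp m δ s).deriv

/-- The ramp is `C¹` (indeed smooth). [folklore] -/
theorem contDiff_arctanRamp (m δ : ℝ) : ContDiff ℝ 1 (fun s : ℝ => Real.arctan ((s - m) / δ)) :=
  Real.contDiff_arctan.comp ((contDiff_id.sub contDiff_const).div_const δ)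

/-- `|β| ≤ π/2`. [folklore] -/
theorem norm_arctanRamp_le (m δ s : ℝ) : ‖Real.arctan ((s - m) / δ)‖ ≤ Real.pi / 2 := by
  rw [Real.norm_eq_abs, abs_le]
  exact ⟨(Real.neg_pi_div_two_lt_arctan _).le, (Real.arctan_lt_pi_div_two _).le⟩

/-- `0 ≤ β′ ≤ 1/δ` (`δ > 0`). [folklore] -/
theorem deriv_arctanRamp_nonneg {δ : ℝ} (hδ : 0 < δ) (m s : ℝ) : 0 ≤ deriv (fun s : ℝ => Real.arctan ((s - m) / δ)) s := by
  rw [deriv_arctanRamp]; positivity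

/-- `‖β′‖ ≤ 1/δ` (`δ > 0`). [folklore] -/
theorem norm_deriv_arctanRamp_le {δ : ℝ} (hδ : 0 < δ) (m s : ℝ) :
    ‖deriv (fun s : ℝ => Real.arctan ((s - m) / δ)) s‖ ≤ 1 / δ := by
  rw [Real.norm_of_nonneg (deriv_arctanRamp_nonneg hδ m s), deriv_arctanRamp]
  have h1 : 1 / (1 + ((s - m) / δ) ^ 2) ≤ 1 := by
    rw [div_le_one (by positivity)]; nlinarith [sq_nonneg ((s - m) / δ)]
  calc 1 / (1 + ((s - m) / δ) ^ 2) * (1 / δ) ≤ 1 * (1 / δ) := by gcongr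
    _ = 1 / δ := one_mul _

/-- On the band `|s − m| ≤ δ`: `β′(s) ≥ 1/(2δ)`. [folklore] -/
theorem deriv_arctanRamp_ge {δ : ℝ} (hδ : 0 < δ) {m s : ℝ} (hs : |s - m| ≤ δ) :
    1 / (2 * δ) ≤ deriv (fun s : ℝ => Real.arctan ((s - m) / δ)) s := by
  rw [deriv_arctanRamp]
  have hx : ((s - m) / δ) ^ 2 ≤ 1 := by
    have h1 : |(s - m) / δ| ≤ 1 := by rw [abs_div, abs_of_pos hδ, div_le_one hδ]; exact hs
    have h2 : ((s - m) / δ) ^ 2 = |(s - m) / δ| ^ 2 := (sq_abs _).symm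
    rw [h2]; nlinarith [abs_nonneg ((s - m) / δ)]
  have h3 : 1 / 2 ≤ 1 / (1 + ((s - m) / δ) ^ 2) := by
    rw [div_le_div_iff₀ (by norm_num) (by positivity)]; nlinarith
  calc 1 / (2 * δ) = 1 / 2 * (1 / δ) := by ring
    _ ≤ 1 / (1 + ((s - m) / δ) ^ 2) * (1 / δ) := by gcongr

end Ramp

/-! ## Volume of balls and an `L²` bookkeeping lemma -/

section Balls

/-- `vol(B(0,r)) = r³ · vol(B(0,1))` in `ℝ³` (real form, `r ≥ 0`). [folklore] -/
theorem volume_ball_toReal {r : ℝ} (hr : 0 ≤ r) :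
    (volume (ball (0 : EuclideanSpace ℝ (Fin 3)) r)).toReal =
      r ^ 3 * (volume (ball (0 : EuclideanSpace ℝ (Fin 3)) 1)).toReal := by
  rw [Measure.addHaar_ball volume (0 : EuclideanSpace ℝ (Fin 3)) hr, finrank_euclideanSpace_fin, ENNReal.toReal_mul,
    ENNReal.toReal_ofReal (by positivity)]

end Balls

/-! ## Bernoulli bands are kinetically thin -/

section Bands

set_option maxHeartbeats 400000 in
/-- **«BERNOULLI BANDS ARE KINETICALLY THIN» (weak class, `0 ≤ γ < ½`).**  Let `V ∈ L⁶(B(0,r))` for every `r`, `G ∈ L²(B(0,r))` for every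
`r`, `V` weakly divergence free, `P ∈ L^{3/2}(B(0,r))` for every `r`, let `ℋ = selfSimilarBernoulli γ 0 V P` have the Lamb-form weak gradient on
`ℝ³`, and let the `A`-growth `∫_{B_L}‖V‖² ≤ c_A L³` hold for `L ≥ L₀`.  Then there is `C ≥ 0` such that for all `L ≥ max L₀ 1`, every level
`m` and every width `δ > 0`:

  `∫_{B(0,L) ∩ {|ℋ − m| ≤ δ}} ‖W‖² ≤ C · δ · L³`   (`W = selfSimilarTransport γ 0 V`).

A Bernoulli band of width `δ` carries only the fraction `≍ δ/L²` of the similarity kinetic energy `∫_{B_L}‖W‖² ≍ L⁵` — the Eulerian form of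
«a similarity orbit crosses a band of width `δ` in time `δ/((1−2γ)|W|²)`».  Proof: the renormalised law (`renormalized_transport_law`) for the
ramp `β = arctan((· − m)/δ)` (`|β| ≤ π/2`, `0 ≤ β′ ≤ 1/δ`, `β′ ≥ 1/(2δ)` on the band) tested with the Tao cutoff `θ_{2L,L}` (`= 1` on `B_L`,
`|Dθ(x)[W x]| ≤ (M/L²)|⟪x, W x⟫| ≤ M(9γ+5) + M‖V x‖²/L²` on `B_{3L}`, `= 0` off it):
`(1−2γ)/(2δ) ∫_{B_L∩band}‖W‖² ≤ ∫β(ℋ)⟪W,∇θ⟫ + 3γ∫θβ(ℋ) ≤ (π/2)[(M(9γ+5) + 3γ)·vol B_{3L} + (M/L²)∫_{B_{3L}}‖V‖²] ≤ K L³`.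
[folklore; cf. ConstantinIgnatovaVicol2026Putative §3.4.3 (3.31); Tao2011 §8 (58)] -/
theorem setIntegral_band_norm_transport_sq_le {γ : ℝ} (hγ0 : 0 ≤ γ) (hγ : γ < 1 / 2)
    (hV6 : ∀ r : ℝ, MemLp V 6 (volume.restrict (ball (0 : EuclideanSpace ℝ (Fin 3)) r)))
    (hG2 : ∀ r : ℝ, MemLp G 2 (volume.restrict (ball (0 : EuclideanSpace ℝ (Fin 3)) r)))
    (hP32 : ∀ r : ℝ, MemLp P (3 / 2 : ℝ≥0∞) (volume.restrict (ball (0 : EuclideanSpace ℝ (Fin 3)) r)))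
    (hdiv : IsWeaklyDivFree V)
    (hH : HasWeakFDerivOn (⊤ : Opens (EuclideanSpace ℝ (Fin 3))) volume (selfSimilarBernoulli γ 0 V P)
      (fun x => (2 * γ - 1) • innerSL ℝ (selfSimilarTransport γ 0 V x) +
        (innerSL ℝ (selfSimilarTransport γ 0 V x)).comp (G x) - innerSL ℝ (G x (selfSimilarTransport γ 0 V x))))
    {cA L₀ : ℝ} (hcA : 0 ≤ cA)
    (hA : ∀ L : ℝ, L₀ ≤ L → ∫ x in ball (0 : EuclideanSpace ℝ (Fin 3)) L, ‖V x‖ ^ 2 ≤ cA * L ^ 3) :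
    ∃ C : ℝ, 0 ≤ C ∧ ∀ L : ℝ, max L₀ 1 ≤ L → ∀ m δ : ℝ, 0 < δ →
      ∫ x in ball (0 : EuclideanSpace ℝ (Fin 3)) L ∩ {x | |selfSimilarBernoulli γ 0 V P x - m| ≤ δ},
          ‖selfSimilarTransport γ 0 V x‖ ^ 2 ≤ C * δ * L ^ 3 := by
  obtain ⟨M, hM⟩ := exists_bound_deriv_smoothTransition
  have hM0 : 0 ≤ M := (norm_nonneg _).trans (hM 0)
  have hM' : ∀ s, |deriv Real.smoothTransition s| ≤ M := fun s => by rw [← Real.norm_eq_abs]; exact hM s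
  set v₁ : ℝ := (volume (ball (0 : EuclideanSpace ℝ (Fin 3)) 1)).toReal with hv₁
  have hv₁0 : 0 ≤ v₁ := ENNReal.toReal_nonneg
  have hπ0 : 0 ≤ Real.pi / 2 := by positivity
  -- the constant
  set K : ℝ := Real.pi / 2 * (27 * ((M * (9 * γ + 5) + 3 * γ) * v₁ + M * cA)) with hKdef
  have hK0 : 0 ≤ K := by positivity
  have h12γ : 0 < 1 - 2 * γ := by linarith
  refine ⟨2 / (1 - 2 * γ) * K, by positivity, fun L hL m δ hδ => ?_⟩
  have hL₀L : L₀ ≤ L := le_trans (le_max_left _ _) hL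
  have hL1 : 1 ≤ L := le_trans (le_max_right _ _) hL
  have hL0 : 0 < L := lt_of_lt_of_le one_pos hL1
  set Hb : EuclideanSpace ℝ (Fin 3) → ℝ := selfSimilarBernoulli γ 0 V P with hHb
  set W : EuclideanSpace ℝ (Fin 3) → EuclideanSpace ℝ (Fin 3) := selfSimilarTransport γ 0 V with hWdef
  set β : ℝ → ℝ := fun s => Real.arctan ((s - m) / δ) with hβdef
  set θ : EuclideanSpace ℝ (Fin 3) → ℝ := taoCutoff (2 * L) L with hθdef
  set B3 : Set (EuclideanSpace ℝ (Fin 3)) := ball (0 : EuclideanSpace ℝ (Fin 3)) (3 * L) with hB3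
  haveI hB3fin : IsFiniteMeasure ((volume : Measure (EuclideanSpace ℝ (Fin 3))).restrict B3) :=
    isFiniteMeasure_restrict.2 measure_ball_lt_top.ne
  have hB3m : MeasurableSet B3 := measurableSet_ball
  have hB3top : volume B3 ≠ ⊤ := measure_ball_lt_top.ne
  have hvolB3 : volume.real B3 = 27 * L ^ 3 * v₁ := by
    rw [measureReal_def, hB3, volume_ball_toReal (by positivity)]; ring
  -- ### measurability
  have hHl : LocallyIntegrable Hb volume := locallyIntegrableOn_univ.1 (by
    simpa only [Opens.coe_top] using hH.locallyIntegrableOn)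
  have hHm : AEStronglyMeasurable Hb volume := hHl.aestronglyMeasurable
  have hVl : LocallyIntegrable V volume := WeakBernoulli.locallyIntegrable_of_memLp_six_ball hV6
  have hVm : AEStronglyMeasurable V volume := hVl.aestronglyMeasurable
  have hWm : AEStronglyMeasurable W volume := (locallyIntegrable_transport (γ := γ) hVl).aestronglyMeasurable
  -- ### the test function `θ = θ_{2L,L}`
  have hθt : IsTestFunctionOn (⊤ : Opens (EuclideanSpace ℝ (Fin 3))) θ :=
    ⟨contDiff_taoCutoff _ _, hasCompactSupport_taoCutoff (by positivity) hL0.le, fun _ _ => trivial⟩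
  have hθ0 : ∀ x, 0 ≤ θ x := fun x => taoCutoff_nonneg _ _ x
  have hθ1 : ∀ x, θ x ≤ 1 := fun x => taoCutoff_le_one _ _ x
  have hθc : Continuous θ := continuous_taoCutoff _ _
  have hθone : ∀ x ∈ ball (0 : EuclideanSpace ℝ (Fin 3)) L, θ x = 1 := fun x hx => by
    rw [mem_ball, dist_zero_right] at hx
    exact taoCutoff_eq_one_of_norm_le (by positivity) hL0 (by linarith) (by linarith [hx.le])
  have hθzero : ∀ x, x ∉ B3 → θ x = 0 := fun x hx => by
    rw [hB3, mem_ball, dist_zero_right, not_lt] at hx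
    exact taoCutoff_eq_zero (by positivity) hL0.le (by linarith)
  have hDθzero : ∀ x, x ∉ B3 → fderiv ℝ θ x (W x) = 0 := fun x hx => by
    rw [hB3, mem_ball, dist_zero_right, not_lt] at hx
    refine HighSetFlux.fderiv_taoCutoff_apply_eq_zero_of_not_mem_layer hL0 (by positivity) (fun h => ?_) (W x)
    have h2 : ‖x‖ ≤ 2 * L := h.2
    linarith
  -- ### the ramp
  have hβ1 : ContDiff ℝ 1 β := contDiff_arctanRamp m δ
  have hβ'le : ∀ z, ‖deriv β z‖ ≤ 1 / δ := norm_deriv_arctanRamp_le hδ m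
  have hβ'c : Continuous (deriv β) := hβ1.continuous_deriv le_rfl
  -- ### the renormalised law
  have hlaw := renormalized_transport_law hV6 hG2 hP32 hdiv hH hβ1 hβ'le hθt
  -- ### (U1) the flux term `|∫ β(ℋ)⟪W,∇θ⟫| ≤ (π/2)[M(9γ+5)·vol B_{3L} + (M/L²)∫_{B_{3L}}‖V‖²]`
  have hV2B3 : MemLp V 2 (volume.restrict B3) := (hV6 (3 * L)).mono_exponent (by norm_num)
  have hIV2 : IntegrableOn (fun x => ‖V x‖ ^ 2) B3 volume := (memLp_two_iff_integrable_sq_norm hV2B3.1).1 hV2B3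
  set g₁ : EuclideanSpace ℝ (Fin 3) → ℝ :=
    B3.indicator fun x => Real.pi / 2 * (M * (9 * γ + 5) + M / L ^ 2 * ‖V x‖ ^ 2) with hg₁
  have hIc : IntegrableOn (fun _ : EuclideanSpace ℝ (Fin 3) => M * (9 * γ + 5)) B3 volume := integrableOn_const (hs := hB3top)
  have hIcV : IntegrableOn (fun x => M * (9 * γ + 5) + M / L ^ 2 * ‖V x‖ ^ 2) B3 volume := hIc.add (hIV2.const_mul _)
  have hg₁i_on : IntegrableOn (fun x => Real.pi / 2 * (M * (9 * γ + 5) + M / L ^ 2 * ‖V x‖ ^ 2)) B3 volume :=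
    hIcV.const_mul _
  have hg₁i : Integrable g₁ volume := hg₁i_on.integrable_indicator hB3m
  have hpt₁ : ∀ x, ‖β (Hb x) * ⟪W x, gradient θ x⟫‖ ≤ g₁ x := by
    intro x
    by_cases hx : x ∈ B3
    · rw [hg₁, indicator_of_mem hx, norm_mul, inner_gradient_eq_fderiv]
      have hx3 : ‖x‖ ≤ 3 * L := by
        rw [hB3, mem_ball, dist_zero_right] at hx; exact hx.le
      have h1 : ‖fderiv ℝ θ x (W x)‖ ≤ M / L ^ 2 * |⟪x, W x⟫| := by
        rw [Real.norm_eq_abs]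
        refine (HighSetFlux.abs_fderiv_taoCutoff_apply_le hL0 (by positivity) hM' x (W x)).trans (le_of_eq ?_)
        rw [show L * (2 * L) = 2 * L ^ 2 by ring, mul_div_mul_left _ _ (two_ne_zero' ℝ)]
      have h2 : |⟪x, W x⟫| ≤ (9 * γ + 5) * L ^ 2 + ‖V x‖ ^ 2 := by
        have e : ⟪x, W x⟫ = γ * ‖x‖ ^ 2 + ⟪x, V x⟫ := by
          rw [hWdef, selfSimilarTransport_apply, sub_zero, inner_add_right, real_inner_smul_right, real_inner_self_eq_norm_sq]
        rw [e]
        have h3 : |⟪x, V x⟫| ≤ ‖x‖ * ‖V x‖ := abs_real_inner_le_norm _ _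
        have h4 : ‖x‖ * ‖V x‖ ≤ (‖x‖ ^ 2 + ‖V x‖ ^ 2) / 2 := by nlinarith [sq_nonneg (‖x‖ - ‖V x‖)]
        have h5 : ‖x‖ ^ 2 ≤ 9 * L ^ 2 := by nlinarith [norm_nonneg x]
        calc |γ * ‖x‖ ^ 2 + ⟪x, V x⟫| ≤ |γ * ‖x‖ ^ 2| + |⟪x, V x⟫| := abs_add_le _ _
          _ ≤ γ * (9 * L ^ 2) + (9 * L ^ 2 + ‖V x‖ ^ 2) / 2 := by
              rw [abs_of_nonneg (by positivity)]
              exact add_le_add (mul_le_mul_of_nonneg_left h5 hγ0) (h3.trans (h4.trans (by linarith)))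
          _ ≤ (9 * γ + 5) * L ^ 2 + ‖V x‖ ^ 2 := by nlinarith [sq_nonneg L, sq_nonneg ‖V x‖]
      have hL2 : 0 < L ^ 2 := by positivity
      calc ‖β (Hb x)‖ * ‖fderiv ℝ θ x (W x)‖ ≤ Real.pi / 2 * (M / L ^ 2 * |⟪x, W x⟫|) :=
            mul_le_mul (norm_arctanRamp_le m δ _) h1 (norm_nonneg _) hπ0
        _ ≤ Real.pi / 2 * (M / L ^ 2 * ((9 * γ + 5) * L ^ 2 + ‖V x‖ ^ 2)) := by gcongr
        _ = Real.pi / 2 * (M * (9 * γ + 5) + M / L ^ 2 * ‖V x‖ ^ 2) := by field_simp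
    · rw [hg₁, indicator_of_notMem hx, inner_gradient_eq_fderiv, hDθzero x hx, mul_zero, norm_zero]
  have hU1 : ‖∫ x, β (Hb x) * ⟪W x, gradient θ x⟫‖ ≤
      Real.pi / 2 * (M * (9 * γ + 5) * (27 * L ^ 3 * v₁) + M / L ^ 2 * ∫ x in B3, ‖V x‖ ^ 2) := by
    refine (norm_integral_le_of_norm_le hg₁i (Eventually.of_forall hpt₁)).trans (le_of_eq ?_)
    rw [hg₁, integral_indicator hB3m, integral_const_mul, integral_add hIc (hIV2.const_mul _),
      setIntegral_const, integral_const_mul, smul_eq_mul, hvolB3]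
    ring
  -- ### (U2) the mass term `|∫ θ β(ℋ)| ≤ (π/2) vol B_{3L}`
  set g₂ : EuclideanSpace ℝ (Fin 3) → ℝ := B3.indicator fun _ => Real.pi / 2 with hg₂
  have hIc₂ : IntegrableOn (fun _ : EuclideanSpace ℝ (Fin 3) => Real.pi / 2) B3 volume := integrableOn_const (hs := hB3top)
  have hg₂i : Integrable g₂ volume := hIc₂.integrable_indicator hB3m
  have hpt₂ : ∀ x, ‖θ x * β (Hb x)‖ ≤ g₂ x := by
    intro x
    by_cases hx : x ∈ B3
    · rw [hg₂, indicator_of_mem hx, norm_mul, Real.norm_of_nonneg (hθ0 x)]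
      calc θ x * ‖β (Hb x)‖ ≤ 1 * (Real.pi / 2) := mul_le_mul (hθ1 x) (norm_arctanRamp_le m δ _) (norm_nonneg _) zero_le_one
        _ = Real.pi / 2 := one_mul _
    · rw [hg₂, indicator_of_notMem hx, hθzero x hx, zero_mul, norm_zero]
  have hU2 : ‖∫ x, θ x * β (Hb x)‖ ≤ Real.pi / 2 * (27 * L ^ 3 * v₁) := by
    refine (norm_integral_le_of_norm_le hg₂i (Eventually.of_forall hpt₂)).trans (le_of_eq ?_)
    rw [hg₂, integral_indicator hB3m, setIntegral_const, smul_eq_mul, hvolB3]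
    ring
  -- ### the `A`-growth on `B_{3L}`
  have hA3 : ∫ x in B3, ‖V x‖ ^ 2 ≤ cA * (3 * L) ^ 3 := hA (3 * L) (by linarith)
  -- ### upper bound for `I = ∫ θ β′(ℋ) |W|²`
  set I : ℝ := ∫ x, θ x * (deriv β (Hb x) * ‖W x‖ ^ 2) with hIdef
  have hIle : (1 - 2 * γ) * I ≤ K * L ^ 3 := by
    have e : (1 - 2 * γ) * I = (∫ x, β (Hb x) * ⟪W x, gradient θ x⟫) + 3 * γ * ∫ x, θ x * β (Hb x) := by
      rw [hlaw]; ring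
    rw [e]
    have h1 := (le_abs_self _).trans ((Real.norm_eq_abs _).symm.le.trans hU1)
    have h2 := (le_abs_self _).trans ((Real.norm_eq_abs _).symm.le.trans hU2)
    have h3 : M / L ^ 2 * ∫ x in B3, ‖V x‖ ^ 2 ≤ M * cA * (27 * L ^ 3) := by
      have hL2 : 1 ≤ L ^ 2 := one_le_pow₀ hL1
      calc M / L ^ 2 * ∫ x in B3, ‖V x‖ ^ 2 ≤ M / L ^ 2 * (cA * (3 * L) ^ 3) :=
            mul_le_mul_of_nonneg_left hA3 (by positivity)
        _ = (M * cA * (27 * L ^ 3)) / L ^ 2 := by ring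
        _ ≤ M * cA * (27 * L ^ 3) := div_le_self (by positivity) hL2
    have hγ3 : 0 ≤ 3 * γ := by positivity
    calc (∫ x, β (Hb x) * ⟪W x, gradient θ x⟫) + 3 * γ * ∫ x, θ x * β (Hb x)
        ≤ Real.pi / 2 * (M * (9 * γ + 5) * (27 * L ^ 3 * v₁) + M / L ^ 2 * ∫ x in B3, ‖V x‖ ^ 2) +
            3 * γ * (Real.pi / 2 * (27 * L ^ 3 * v₁)) := add_le_add h1 (mul_le_mul_of_nonneg_left h2 hγ3)
      _ ≤ Real.pi / 2 * (M * (9 * γ + 5) * (27 * L ^ 3 * v₁) + M * cA * (27 * L ^ 3)) +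
            3 * γ * (Real.pi / 2 * (27 * L ^ 3 * v₁)) := by gcongr
      _ = K * L ^ 3 := by rw [hKdef]; ring
  -- ### lower bound for `I`: the band inside `B_L`
  set S : Set (EuclideanSpace ℝ (Fin 3)) := ball (0 : EuclideanSpace ℝ (Fin 3)) L ∩ {x | |Hb x - m| ≤ δ} with hSdef
  have hSB3 : S ⊆ B3 := fun x hx => by
    have h1 : x ∈ ball (0 : EuclideanSpace ℝ (Fin 3)) L := hx.1
    rw [mem_ball, dist_zero_right] at h1
    rw [hB3, mem_ball, dist_zero_right]; linarith
  have hSn : NullMeasurableSet S volume :=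
    measurableSet_ball.nullMeasurableSet.inter
      (nullMeasurableSet_le ((hHm.aemeasurable.sub_const m).abs) aemeasurable_const)
  have hW2B3 : MemLp W 2 (volume.restrict B3) := (memLp_transport_six (γ := γ) (hV6 (3 * L))).mono_exponent (by norm_num)
  have hIW2 : IntegrableOn (fun x => ‖W x‖ ^ 2) B3 volume := (memLp_two_iff_integrable_sq_norm hW2B3.1).1 hW2B3
  have hfm : AEStronglyMeasurable (fun x => θ x * (deriv β (Hb x) * ‖W x‖ ^ 2)) volume :=
    hθc.aestronglyMeasurable.mul ((hβ'c.comp_aestronglyMeasurable hHm).mul (hWm.norm.pow 2))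
  have hfi_on : IntegrableOn (fun x => θ x * (deriv β (Hb x) * ‖W x‖ ^ 2)) B3 volume := by
    refine Integrable.mono' (hIW2.const_mul (1 / δ)) hfm.restrict (Eventually.of_forall fun x => ?_)
    rw [norm_mul, norm_mul, norm_pow, norm_norm, Real.norm_of_nonneg (hθ0 x)]
    calc θ x * (‖deriv β (Hb x)‖ * ‖W x‖ ^ 2) ≤ 1 * (1 / δ * ‖W x‖ ^ 2) :=
          mul_le_mul (hθ1 x) (mul_le_mul_of_nonneg_right (hβ'le _) (by positivity)) (by positivity) zero_le_one
      _ = 1 / δ * ‖W x‖ ^ 2 := one_mul _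
  have hfi : Integrable (fun x => θ x * (deriv β (Hb x) * ‖W x‖ ^ 2)) volume :=
    hfi_on.integrable_of_forall_notMem_eq_zero fun x hx => by rw [hθzero x hx, zero_mul]
  have hfnn : ∀ x, 0 ≤ θ x * (deriv β (Hb x) * ‖W x‖ ^ 2) := fun x =>
    mul_nonneg (hθ0 x) (mul_nonneg (deriv_arctanRamp_nonneg hδ m _) (by positivity))
  have hlow : 1 / (2 * δ) * ∫ x in S, ‖W x‖ ^ 2 ≤ I := by
    calc 1 / (2 * δ) * ∫ x in S, ‖W x‖ ^ 2 = ∫ x in S, 1 / (2 * δ) * ‖W x‖ ^ 2 := (integral_const_mul _ _).symm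
      _ ≤ ∫ x in S, θ x * (deriv β (Hb x) * ‖W x‖ ^ 2) := by
          refine setIntegral_mono_ae_restrict ((hIW2.mono_set hSB3).const_mul _) (hfi_on.mono_set hSB3) ?_
          filter_upwards [ae_restrict_mem₀ hSn] with x hx
          rw [hθone x hx.1, one_mul]
          exact mul_le_mul_of_nonneg_right (deriv_arctanRamp_ge hδ hx.2) (by positivity)
      _ ≤ I := setIntegral_le_integral hfi (Eventually.of_forall hfnn)
  -- ### combine
  have hSint0 : 0 ≤ ∫ x in S, ‖W x‖ ^ 2 := integral_nonneg fun x => by positivity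
  have hfin : ∫ x in S, ‖W x‖ ^ 2 ≤ 2 * δ * I := by
    have h := mul_le_mul_of_nonneg_left hlow (by positivity : (0 : ℝ) ≤ 2 * δ)
    rwa [← mul_assoc, show 2 * δ * (1 / (2 * δ)) = 1 by field_simp, one_mul] at h
  calc ∫ x in S, ‖W x‖ ^ 2 ≤ 2 * δ * I := hfin
    _ = 2 * δ / (1 - 2 * γ) * ((1 - 2 * γ) * I) := by field_simp
    _ ≤ 2 * δ / (1 - 2 * γ) * (K * L ^ 3) := mul_le_mul_of_nonneg_left hIle (by positivity)
    _ = 2 / (1 - 2 * γ) * K * δ * L ^ 3 := by ring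

end Bands

end WeakRenormalized

end Summit.NavierStokesRegularity.NavierStokesRegularity.Theorems.PowerGaugeEulerLiouville
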